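import Summits.ValiantsHypothesis.ValiantsHypothesis.Theorems.SymPencilPerFourInnerRankFirstFormA

/-!
# Route `SymPencil` — inner rank of the `2 | 2` row split of `per_4`: the NORMAL FORM of a
# `≤ 11`-square joint family (`--supports` stmt-ValiantsHypothesis-5674 `SdcSuperquadratic`;
# (8,8) column of the size tables, isotropic-kernel route, memo `NOTE-p6g15-5674-IR12-reduction.md`
# §3 / §10, steps (B1)–(B5) assembled)

**Theorem** (`normalForm`).  Let `Σ_r c_r t_r((a,b),(y₂,y₃))² = per (a; b; y₂; y₃)` over a field
of characteristic zero with `|ι| ≤ 11` squares and non-zero weights `c_r`.  Then EITHER there are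
vectors `v₀, v₀' ∈ K^ι` with `(t_r((a,0),(y₂,0)))_r ∈ K v₀` and `(t_r((0,b),(0,y₃)))_r ∈ K v₀'`
for all `a, b, y₂, y₃` (the `y₂`-block of the `a`-part and the `y₃`-block of the `b`-part are
"scalar": `A₂(a)y₂ = ψ(a,y₂)·v₀`, `B₃(b)y₃ = ψ'(b,y₃)·v₀'`), OR the same with `y₂ ↔ y₃`
(`A₃`, `B₂` scalar).

Proof: the four slot theorems (`…SlotA`, `…Slots`), the pairing `NotBoth.not_both_fst` (and its
`y₂ ↔ y₃` mirror), and `FirstFormA.firstForm_A₂ / firstForm_B₃` (applied to the design and to its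
`y₂ ↔ y₃` swap).  WHAT THIS LEAVES of the (8,8)-column programme (cells `(8,8,10)`, `(8,8,11)` ⟸
IR10 / IR11): the analysis of the normal form (memo §3: `v₀, v₀'` isotropic and orthogonal to the
other blocks ⇒ PURE design `T(u)y = B₂(b)y₂ + A₃(a)y₃` or the PEELED case) and then the pure
Gram problem P1 (memo §4–§6, numerically true, unproved) and R2.  Honest framing: a CONDITIONAL
reduction; no cell closes; the window `27 ≤ sdc(per_4) ≤ 29`, the crux and `VP ≠ VNP` are
untouched.  No definitions, no named facts. [folklore]
-/

noncomputable section

-- single-conjunct layout: Sub = Summit, duplicated namespace component intended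
set_option linter.dupNamespace false

namespace Summit.ValiantsHypothesis.ValiantsHypothesis.Theorems.SymPencilPerFourInnerRankNormalForm

open Matrix Finset Module
open Summit.ValiantsHypothesis.ValiantsHypothesis.Theorems.SymPencilPerFourInnerRankTenPairs
open Summit.ValiantsHypothesis.ValiantsHypothesis.Theorems.SymPencilPerFourInnerRankSlotA
open Summit.ValiantsHypothesis.ValiantsHypothesis.Theorems.SymPencilPerFourInnerRankSlots
open Summit.ValiantsHypothesis.ValiantsHypothesis.Theorems.SymPencilPerFourInnerRankNotBoth
open Summit.ValiantsHypothesis.ValiantsHypothesis.Theorems.SymPencilPerFourInnerRankFirstFormA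

variable {K : Type*} [Field K] {ι : Type*} [Fintype ι]

/-- **Normal form of a `≤ 11`-square joint family.**  See the module docstring. [folklore] -/
theorem normalForm [CharZero K] [DecidableEq ι] (hι : Fintype.card ι ≤ 11)
    (c : ι → K) (hc : ∀ r, c r ≠ 0)
    (t : ι → (((Fin 4 → K) × (Fin 4 → K)) →ₗ[K] ((Fin 4 → K) × (Fin 4 → K)) →ₗ[K] K))
    (hJ : ∀ a b y₂ y₃ : Fin 4 → K,
      ∑ r, c r * (t r (a, b) (y₂, y₃)) ^ 2 = (Matrix.of ![a, b, y₂, y₃]).permanent) :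
    (∃ v₀ v₀' : ι → K,
      (∀ (a x : Fin 4 → K), ∃ s : K, (fun r => t r (a, 0) (x, 0)) = s • v₀) ∧
      (∀ (b x : Fin 4 → K), ∃ s : K, (fun r => t r (0, b) (0, x)) = s • v₀')) ∨
    (∃ w₀ w₀' : ι → K,
      (∀ (a x : Fin 4 → K), ∃ s : K, (fun r => t r (a, 0) (0, x)) = s • w₀) ∧
      (∀ (b x : Fin 4 → K), ∃ s : K, (fun r => t r (0, b) (x, 0)) = s • w₀')) := by
  -- the `y₂ ↔ y₃`-swapped design
  set t' : ι → (((Fin 4 → K) × (Fin 4 → K)) →ₗ[K] ((Fin 4 → K) × (Fin 4 → K)) →ₗ[K] K) :=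
    fun r => (t r).compl₂ (LinearEquiv.prodComm K (Fin 4 → K) (Fin 4 → K)).toLinearMap with ht'
  have hJ' : ∀ a b y₂ y₃ : Fin 4 → K,
      ∑ r, c r * (t' r (a, b) (y₂, y₃)) ^ 2 = (Matrix.of ![a, b, y₂, y₃]).permanent :=
    hJ_yswap c t hJ
  have ht'ap : ∀ r (u : (Fin 4 → K) × (Fin 4 → K)) (x : Fin 4 → K),
      t' r u (x, 0) = t r u (0, x) ∧ t' r u (0, x) = t r u (x, 0) := fun r u x => by
    simp [ht']
  rcases slotA_rank_le_one hι c hc t hJ with hA | hA <;>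
    rcases slotB_rank_le_one hι c hc t hJ with hB | hB
  · exact (not_both_fst c t hJ hA hB).elim
  · -- (iA ∧ iiB): the stated normal form
    left
    obtain ⟨v₀, hv₀⟩ := firstForm_A₂ hι c hc t hJ hA
    obtain ⟨v₀', hv₀'⟩ := firstForm_B₃ hι c hc t hJ hB
    exact ⟨v₀, v₀', hv₀, hv₀'⟩
  · -- (iiA ∧ iB): the mirrored normal form, through the swapped design
    right
    obtain ⟨w₀, hw₀⟩ := firstForm_A₂ hι c hc t' hJ' (fun a x x' r r' => by
      simp only [(ht'ap _ _ _).1]; exact hA a x x' r r')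
    obtain ⟨w₀', hw₀'⟩ := firstForm_B₃ hι c hc t' hJ' (fun b x x' r r' => by
      simp only [(ht'ap _ _ _).2]; exact hB b x x' r r')
    refine ⟨w₀, w₀', fun a x => ?_, fun b x => ?_⟩
    · obtain ⟨s, hs⟩ := hw₀ a x
      exact ⟨s, by rw [← hs]; funext r; exact ((ht'ap r _ _).1).symm⟩
    · obtain ⟨s, hs⟩ := hw₀' b x
      exact ⟨s, by rw [← hs]; funext r; exact ((ht'ap r _ _).2).symm⟩
  · -- (iiA ∧ iiB): excluded (mirror of `not_both_fst`)
    exact (not_both_fst c t' hJ' (fun a x x' r r' => by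
      simp only [(ht'ap _ _ _).1]; exact hA a x x' r r') (fun b x x' r r' => by
      simp only [(ht'ap _ _ _).1]; exact hB b x x' r r')).elim

end Summit.ValiantsHypothesis.ValiantsHypothesis.Theorems.SymPencilPerFourInnerRankNormalForm

end
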